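import Literature.MathematicalPhysics.KineticTheory.EvenPolynomialPotentials
import HarnessLib

/-!
# Buttà–Marchioro 2016, §3: the box partial dynamics and the limit construction of the flow

Topic `Literature/MathematicalPhysics/KineticTheory`; companion of
`InfiniteChainSuperstableDynamics.lean` (imported through its proofs companion
`EvenPolynomialPotentials.lean`, whose `IsEvenPolyOfDegree.neg_apply` is used; BM's local energy `bmLocalEnergy` = `W_{μ,k}` (2.4), growth
functional `bmGrowth` = `Q` (2.5), good set `bmGood` = `𝒳₀`, polynomial hypothesis
`IsEvenPolyOfDegree`, and the named facts `ButtaMarchioro2016_thm21_chain` (Thm 2.1, the group `Φ_t`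
on `𝒳₀`) / `_eq26_chain`) and of `InfiniteChainLightCone.lean` (Thm 2.2). Source: P. Buttà,
C. Marchioro, *Dynamics of infinite classical anharmonic crystals*, J. Stat. Phys. **164** (2016)
680–692 = arXiv:1602.01294 (held; read in full), §3 "Proof of Theorem 2.1" [ButtaMarchioro2016].
Vendored for route `CurrentTiltQuench` of `AtomisticToContinuum/FouriersLaw` (support
`SymmetricSetup`, stmt-AtomisticToContinuum-11036; crux `QuenchCurrentDies`, stmt-11028): the two
printed ingredients of Theorem 2.1's PROOF that its statement does not display and that the
set-up items consume —

* how the flow is BUILT: "Given `μ ∈ ℤ^d` and `n ∈ ℕ`, we call `n`-partial dynamics around `μ` the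
  flow `Φ^{μ,n}_t(x)` such that `(q^{μ,n}_i(t), p^{μ,n}_i(t)) = (q_i, p_i)` for all
  `i ∈ ℤ^d ∖ Λ_{μ,n}`, while `{(q^{μ,n}_i(t), p^{μ,n}_i(t))}_{i ∈ Λ_{μ,n}}` is the solution to the
  Cauchy problem `q̇^{μ,n}_i = p^{μ,n}_i`, `ṗ^{μ,n}_i = F^{μ,n}_i(Φ^{μ,n}_t(x))`,
  `(q^{μ,n}_i(0), p^{μ,n}_i(0)) = (q_i, p_i)` (3.1), where, for any `i ∈ Λ_{μ,n}`,
  `F^{μ,n}_i(x) = -∇U(q_i) - ∑_{j ∈ Λ_{μ,n}, |j-i|=1} ∇V(q_i - q_j)` (3.2). We remark that the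
  global existence and uniqueness of the solution to the problem (3.1) is guaranteed since `U` and
  `V` are bounded from below. The solution `Φ_t(x)` to Eq. (2.1) will be obtained by setting
  `Φ_t(x)_i = lim_{n→∞} Φ^{μ,n}_t(x)_i` for all `i ∈ ℤ^d` (3.3), provided that the limit in the
  right-hand side of (3.3) exists and does not depend on `μ ∈ ℤ^d`" (p. 6) — both proved in §3
  (pp. 6–8) for `x ∈ 𝒳₀`, together with `Φ_t(x) ∈ 𝒳₀` ((2.7), p. 8);
* i.e. the flow is the coordinatewise limit of FINITE-DIMENSIONAL Hamiltonian flows in boxes around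
  ANY centre — the handle for measurability of `Φ_t`, for the invariance of Gibbs states (box
  flows preserve the box Gibbs weights) and for shift-covariance (the partial dynamics around `μ`
  of the shifted datum is the shift of the partial dynamics around `μ+1`), none of which BM print
  as theorems.

## Contents

* `OscillatorChain.bmForce` — BM's force (2.2), `F_i(x) = -U'(q_i) - ∑_{|j-i|=1} V'(q_i - q_j)`, and
  `bmForce_eq_force` (PROVED): for even `V` it is the tree's Lanford–Lebowitz–Lieb force
  `OscillatorChain.force` (`V'` is odd — unconditionally for Mathlib's `deriv`), so BM's equations
  (2.1) are the tree's `OscillatorChain.IsSolution`;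
* `OscillatorChain.bmBoxedForce` — the boxed force (3.2) (bonds leaving `Λ_{μ,n}` dropped);
  `OscillatorChain.IsBMPartialSolution` — the `n`-partial dynamics (3.1) as a predicate on curves
  (frozen outside the box);
* named facts `ButtaMarchioro2016_partialDynamics_chain` (the remark after (3.2): global
  well-posedness of (3.1)) and `ButtaMarchioro2016_eq33_chain` ((3.3) for `x ∈ 𝒳₀`: the limit
  exists for every centre `μ`, is independent of `μ`, and the limit map `Φ` has the properties of
  Theorem 2.1 — `Φ_t(𝒳₀) ⊆ 𝒳₀`, `Φ_0 = id`, group law, orbits solve (2.1), growth bound (2.7)).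

## Relation to `ButtaMarchioro2016_thm21_chain` (read before using both)

The accepted Thm 2.1 fact asserts `∃ Φ` with the displayed properties PLUS uniqueness "among
solutions with values in `𝒳₀`" (its reading of the printed word "unique"). The `Φ` of
`ButtaMarchioro2016_eq33_chain` is, for `x ∈ 𝒳₀`, an `𝒳₀`-valued solution from `x`, so under that
uniqueness clause the two flows agree on `𝒳₀`; `eq33` itself asserts no uniqueness (none is
displayed in §3 beyond the independence of `μ`). Nothing here duplicates a declaration of the
companion files: vocabulary is imported (`bmLocalEnergy`, `bmGrowth`, `bmGood`,
`IsEvenPolyOfDegree`), boxes are written `Finset.Icc (μ - n) (μ + n)` as there.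

## Transcription choices

* (3.1) is a predicate on curves `γ : ℝ → ChainConfig` (`HasDerivAt` coordinatewise inside the box,
  constancy outside), like the tree's `IsSeveredSolution` (LLL (9a)–(9c)), from which it differs
  exactly as printed: LLL keep the bonds to the frozen exterior, BM drop them ((3.2) sums over
  `j ∈ Λ_{μ,n}` only).
* (3.3) is stated for every sequence of partial solutions `γ n` from `x` in the boxes `Λ_{μ,n}`
  (they exist and are unique by `ButtaMarchioro2016_partialDynamics_chain`), as
  `Tendsto (fun n => γ n t i) atTop (𝓝 (Φ t x i))` in `ℝ × ℝ`; quantifying over all centres `μ`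
  with one `Φ` encodes "does not depend on `μ`".
* Hypotheses as in the companion facts: `U`, `V` even non-negative polynomials of degrees
  `2σ₁, 2σ₂ ≥ 2` (`IsEvenPolyOfDegree`), `d = ν = 1`.

Everything below is a definition, a proved lemma, or a statement (`Prop`); no fact is asserted.
-/

noncomputable section

open Set Filter
open scoped Topology

namespace Literature.MathematicalPhysics.KineticTheory.HeatConduction

namespace OscillatorChain

variable (P : OscillatorChain)

/-! ### BM's force and the box partial dynamics -/

/-- BM's force on oscillator `i` (scalar case): `F_i(x) = -U'(q_i) - ∑_{j : |j-i|=1} V'(q_i - q_j)`.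
[cite: ButtaMarchioro2016, §2 eq. (2.2)] -/
def bmForce (σ : ChainConfig) (i : ℤ) : ℝ :=
  -deriv P.U (σ i).1 -
    (deriv P.V ((σ i).1 - (σ (i + 1)).1) + deriv P.V ((σ i).1 - (σ (i - 1)).1))

/-- The force of the partial dynamics in the box `Λ`: bonds leaving `Λ` are dropped,
`F^{Λ}_i(x) = -U'(q_i) - ∑_{j ∈ Λ, |j-i|=1} V'(q_i - q_j)`. [cite: ButtaMarchioro2016, §3 eq. (3.2)] -/
def bmBoxedForce (Λ : Finset ℤ) (σ : ChainConfig) (i : ℤ) : ℝ :=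
  -deriv P.U (σ i).1 -
    ((if i + 1 ∈ Λ then deriv P.V ((σ i).1 - (σ (i + 1)).1) else 0) +
      (if i - 1 ∈ Λ then deriv P.V ((σ i).1 - (σ (i - 1)).1) else 0))

/-- `γ` is the partial dynamics in the box `Λ` started from `γ 0`: inside `Λ`, `q̇_i = p_i` and
`ṗ_i = F^{Λ}_i`; outside `Λ` the oscillators stay frozen at their initial values.
[cite: ButtaMarchioro2016, §3 eq. (3.1)] -/
def IsBMPartialSolution (Λ : Finset ℤ) (γ : ℝ → ChainConfig) : Prop :=
  (∀ i ∈ Λ, ∀ t : ℝ, HasDerivAt (fun s => (γ s i).1) (γ t i).2 t ∧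
      HasDerivAt (fun s => (γ s i).2) (P.bmBoxedForce Λ (γ t) i) t) ∧
    ∀ i ∉ Λ, ∀ t : ℝ, γ t i = γ 0 i

/-! ### API (proved) -/

/-- For even `V`, BM's force (2.2) is the tree's (LLL) force: `V'` is odd. [folklore] -/
theorem bmForce_eq_force (hV : ∀ r, P.V (-r) = P.V r) (σ : ChainConfig) (i : ℤ) :
    P.bmForce σ i = P.force σ i := by
  have hodd : ∀ r, deriv P.V (-r) = -deriv P.V r := by
    intro r
    have hfun : (fun x => P.V (-x)) = P.V := funext fun x => hV x
    have h := deriv_comp_neg P.V r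
    rw [hfun] at h
    linarith
  have h1 : deriv P.V ((σ i).1 - (σ (i + 1)).1) = -deriv P.V ((σ (i + 1)).1 - (σ i).1) := by
    rw [← hodd, neg_sub]
  simp only [bmForce, force, interactionForce, h1]
  ring

/-- Under BM's polynomial hypothesis on `V`, BM's equations (2.1)–(2.2) are the tree's
`OscillatorChain.IsSolution` equations (same force). [folklore] -/
theorem bmForce_eq_force_of_isEvenPolyOfDegree {s : ℕ} (hV : IsEvenPolyOfDegree P.V s)
    (σ : ChainConfig) (i : ℤ) : P.bmForce σ i = P.force σ i :=
  P.bmForce_eq_force hV.neg_apply σ i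

/-! ### Named facts (Buttà–Marchioro 2016, §3), chain instances -/

/-- **Buttà–Marchioro 2016, §3, well-posedness of the partial dynamics (remark after (3.2)), for
`d = ν = 1`.** For `U`, `V` even non-negative polynomials of degrees `2σ₁, 2σ₂ ≥ 2`, every box
`Λ_{μ,n}` and every initial datum, the Cauchy problem (3.1) has a global solution and it is unique
("the global existence and uniqueness of the solution to the problem (3.1) is guaranteed since `U`
and `V` are bounded from below": finitely many polynomial ODEs with the conserved, coercive box
energy). Statement only. [cite: ButtaMarchioro2016, §3 remark after eq. (3.2)] -/
def ButtaMarchioro2016_partialDynamics_chain : Prop :=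
  ∀ (P : OscillatorChain) (s₁ s₂ : ℕ), 1 ≤ s₁ → 1 ≤ s₂ →
    IsEvenPolyOfDegree P.U s₁ → IsEvenPolyOfDegree P.V s₂ →
    ∀ (μ : ℤ) (n : ℕ) (σ : ChainConfig),
      (∃ γ : ℝ → ChainConfig, γ 0 = σ ∧ P.IsBMPartialSolution (Finset.Icc (μ - n) (μ + n)) γ) ∧
      ∀ γ₁ γ₂ : ℝ → ChainConfig, γ₁ 0 = σ → P.IsBMPartialSolution (Finset.Icc (μ - n) (μ + n)) γ₁ →
        γ₂ 0 = σ → P.IsBMPartialSolution (Finset.Icc (μ - n) (μ + n)) γ₂ → γ₁ = γ₂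

/-- **Buttà–Marchioro 2016, §3, the limit construction (3.3) of the flow of Theorem 2.1, for
`d = ν = 1`.** For `U`, `V` even non-negative polynomials of degrees `2σ₁, 2σ₂ ≥ 2` (`σ = max`,
`η = (σ-1)/σ`) there is `Φ : ℝ → 𝒳 → 𝒳` such that: (i) for every `x ∈ 𝒳₀`, every centre `μ`,
site `i` and time `t`, along the partial dynamics `Φ^{μ,n}` in the boxes `Λ_{μ,n}` started from
`x`, `Φ^{μ,n}_t(x)_i → Φ_t(x)_i` as `n → ∞` — the limit (3.3) exists and does not depend on `μ`
(§3, pp. 6–7); and this `Φ` is the flow of Theorem 2.1: (ii) `Φ_t(𝒳₀) ⊆ 𝒳₀` ((2.7), p. 8),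
(iii) `Φ_0 = id` and `Φ_{t+s} = Φ_t ∘ Φ_s` on `𝒳₀` ("one-parameter group"), (iv) for `x ∈ 𝒳₀`,
`t ↦ Φ_t(x)` solves (2.1) ("which in turn shows … that it is solution to (2.1)", p. 7; stated with
the tree's `IsSolution`, the same equations by `bmForce_eq_force`), (v) the growth bound (2.7).
No uniqueness is asserted here (see the module docstring for the relation to
`ButtaMarchioro2016_thm21_chain`). Statement only.
[cite: ButtaMarchioro2016, §3 eqs. (3.1)–(3.3) and §2 Thm 2.1] -/
def ButtaMarchioro2016_eq33_chain : Prop :=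
  ∀ (P : OscillatorChain) (s₁ s₂ : ℕ), 1 ≤ s₁ → 1 ≤ s₂ →
    IsEvenPolyOfDegree P.U s₁ → IsEvenPolyOfDegree P.V s₂ →
    ∃ Φ : ℝ → ChainConfig → ChainConfig,
      (∀ σ ∈ P.bmGood, ∀ (μ i : ℤ) (t : ℝ) (γ : ℕ → ℝ → ChainConfig),
        (∀ n : ℕ, γ n 0 = σ ∧ P.IsBMPartialSolution (Finset.Icc (μ - n) (μ + n)) (γ n)) →
          Tendsto (fun n : ℕ => γ n t i) atTop (𝓝 (Φ t σ i))) ∧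
      (∀ t : ℝ, MapsTo (Φ t) P.bmGood P.bmGood) ∧
      (∀ σ ∈ P.bmGood, Φ 0 σ = σ) ∧
      (∀ t s : ℝ, ∀ σ ∈ P.bmGood, Φ (t + s) σ = Φ t (Φ s σ)) ∧
      (∀ σ ∈ P.bmGood, P.IsSolution fun t => Φ t σ) ∧
      ∀ γ' : ℝ, (((max s₁ s₂ : ℕ) : ℝ) - 1) / ((max s₁ s₂ : ℕ) : ℝ) < γ' → γ' < 2 →
        ∀ β' : ℝ, 0 < β' → ∃ C : ℝ, 0 < C ∧ ∀ t : ℝ, 0 < t → ∀ σ ∈ P.bmGood,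
          P.bmGrowth (Φ t σ) ≤ C * P.bmGrowth σ *
            (1 + t ^ (2 / (2 - γ')) * (1 + t ^ β') * P.bmGrowth σ ^ (γ' / (2 - γ')))

end OscillatorChain

end Literature.MathematicalPhysics.KineticTheory.HeatConduction

end
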